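import Mathlib
import Literature.MathematicalPhysics.QuantumFieldTheory.MagnenRivasseauSeneor1993.MRS93TruncatedGaugeDefectIntegrated
import Literature.MathematicalPhysics.QuantumFieldTheory.MagnenRivasseauSeneor1993.MRS93GaussianChangeOfVariables
import HarnessLib

/-!
# Magnen–Rivasseau–Sénéor (CMP 155, 1993), Sect. II.C p.341 tl.14–33 with (II.41)–(II.43) FOR THE CUT-OFF FIELDS ON `Λ`,
# POINTWISE: «A′ = A^{γ,2} = T(γ).A + U(γ)», «A = T⁻¹(A′ − U)», «J(γ) ≡ (1 + λ²γ²)⁻¹»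

statement-level skeleton of a published definition/display with citation tags; the algebra proved; nothing here is a
claim about the Yang–Mills mass gap, about continuum Yang–Mills on `T⁴` without infrared cutoff, or about the Clay
problem — and nothing of Magnen–Rivasseau–Sénéor's expansion or estimates is asserted or formalised

**Citation header (reproduction of PUBLISHED work).** J. Magnen, V. Rivasseau, R. Sénéor, *Construction of YM₄ with
an infrared cutoff*, Commun. Math. Phys. **155** (1993) 325–383 [MagnenRivasseauSeneor1993], Sect. II.C p.341 tl.14–33
with the displays (II.41), (II.42), (II.43); Sect. II.A (II.6) p.329 tl.16–18. Loci `p.NNN tl.nn` = journal page /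
text-layer line of the held scan `paper:magnen1993-cmp155-mrs-ym4-infrared-cutoff` (PDF page = journal page − 324).
Cell pub-balaban-gaps (YM blitz, track G3 «MRS 1993 typed AS PRINTED as the independent second ultraviolet route»), seat
mrs-lit-1 (gen 15); companion prose `run/shared/lean/pub/pub-balaban-gaps/g3/MRS-AS-PRINTED.md` §2, §5. Builds, BY
NAME and without re-declaring anything, on `…MRS93TruncatedGaugeDefectIntegrated` (gen 14: the position-space field
`truncField` = (II.6) literally, its 1-jet `truncJetAt` and `truncJetAt_eq`), `…MRS93PositionSpaceFields` (gens 9–13: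
`Pos`, `field`, `trigPoly`, `jetAt`, `gaugeJetAt`, `IsRealOn`, `RealCoeff`), `…MRS93InfinitesimalGauge` (gen 5, §6:
`affineU`, `gaugeTrunc2_val_eq_Tmat_mulVec_add`, `val_eq_TinvMat_mulVec` ON JETS), `…MRS93TruncatedGauge` (gen 0:
the (II.41)/(II.42) matrices `Tmat`/`TinvMat`, (II.43) `jacobianJ`, `det_Tmat`) and `…MRS93GaussianChangeOfVariables`
(gen 6, §4: the finite-site block matrix `blockT`, `abs_det_blockT`).

**What the paper prints (verbatim, p.341 tl.14–33; text layer p0017, Greek restored).** *«Remark that this change of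
variables is one to one, namely it is possible to compute directly the initial field A in terms of A′, since the
transformation A → A^{γ,2} is invertible. The inversion formula exists (also for higher orders approximations to true
gauge transformations) and is a rational function of γ. (…) For instance, if we write A′ = A^{γ,2} = T(γ).A + U(γ), with
T.A = A − λ[A, γ] and U = ∂γ + 1/2[γ, ∂γ], in su(2) space the matrix of T is T_ab(γ) = δ_ab − ε_abc λγ_c. (II.41) Its
inverse is T⁻¹_ab = (…) (II.42) where H is a small matrix; the transformation A → A′ is therefore inverted by A =
T⁻¹(A′ − U). Furthermore the Jacobian of the change of variables associated to a true gauge transformation is one, since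
the linear piece is an inner automorphism. For the truncated gauge transformation this is no longer exactly true. For
instance for the truncated transformation A → A^{γ,2} the linear piece is A → TA, and the Jacobian is J(γ) ≡ (1 +
λ²γ²)⁻¹. The formal Lebesgue measure changes therefore, if A′ = A^{γ,2} as: Π_x dA(x) → Π_x dA′(x) Π_x (1 +
λ²γ²(x))⁻¹. (II.43)»*

**Why.** The tree proves these sentences twice already, but never for the fields on `Λ`: gen 0 as matrix identities
(`Tmat`, `TinvMat`, `det_Tmat`, `jacobianJ`), gen 5 on formal jets (`gaugeTrunc2_val_eq_Tmat_mulVec_add`,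
`val_eq_TinvMat_mulVec`), gen 6 on a finite set of abstract sites in READING (FD) (`blockT`, `abs_det_blockT`). Since gen 14
the truncated transform `A′` is an honest position-space field `truncField` whose 1-jet IS gen 5's `gaugeTrunc2` on the jets
of `A` and `γ` (`truncJetAt_eq`). This file threads the three through that theorem: the printed change of variables and its
rational inverse hold POINTWISE ON `Λ` for the cut-off fields themselves, and the printed Jacobian `J(γ(x))` is a
continuous function on `Λ` with values in `(0, 1]`, whose finite products over sample points are gen 6's block
determinants — the part of (II.43) that is not «formal».

**What is typed here (namespace `PositionSpace`, continued; everything PROVED; zero `sorry`, zero named facts).**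
* §1 **`truncField_re_eq_Tmat_mulVec_add`** — «A′ = T(γ).A + U(γ)» AT EACH `x ∈ Λ`: for a real cut-off `A` and a real
  cut-off `γ`, the colour vector `(A′^a_μ(x))_a` is `T(γ(x))·(A^a_μ(x))_a + U_μ(γ)(x)` with the (II.41) matrix at the VALUE
  `γ(x)` and gen 5's `U = ∂γ + (λ/2)[γ, ∂γ]` on the jet of `γ` at `x` (gen 5's precision on the printed «1/2» vs «λ/2»
  applies verbatim and is not restated); componentwise `truncField_re_apply`.
* §2 **`jetAt_val_eq_TinvMat_mulVec_truncField`** — «A = T⁻¹(A′ − U)» AT EACH `x`: the cut-off field `A` is recovered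
  from `A′` and `γ` by the printed RATIONAL formula (II.42) («a rational function of γ»: the entries of `TinvMat λ γ(x)` are
  rational in `γ(x)` with the denominator `1 + λ²|γ(x)|²` that never vanishes); **`jetAt_val_eq_of_truncField_eq`** — «this
  change of variables is one to one» pointwise: two real cut-off configurations with the same `A′` (same `λ`, `γ`) have the
  same field values at every point and in every direction.
* §3 the printed Jacobian `J(γ(x)) = (1 + λ²|γ(x)|²)⁻¹` as a FUNCTION ON `Λ` for the cut-off `γ` (gen 0's `jacobianJ` at
  `(gaugeJetAt K γ̃ x).val`, `jacobianJ_gaugeJetAt_eq`; no new definition): `jacobianJ_gaugeJetAt_eq_det` (`= det T(γ(x))⁻¹ = det T⁻¹(γ(x))`), `jacobianJ_gaugeJetAt_pos`/`jacobianJ_gaugeJetAt_le_one`,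
  `continuous_jacobianJ_gaugeJetAt`, `jacobianJ_gaugeJetAt_eq_one_iff` (`J(γ(x)) = 1 ↔ λ = 0 ∨ γ(x) = 0` — «no longer exactly» one), and
  **`prod_jacobianJ_gaugeJetAt_eq`**: for every finite set `X` of sample points, `Π_{x∈X} J(γ(x)) = |det ⊕_{x∈X} T(γ(x))|⁻¹` — gen 6's
  READING (FD) block determinant `abs_det_blockT` evaluated on the VALUES of the cut-off ghost field.
* §4 «The inversion formula … is a rational function of γ» (p.341 tl.16–17): `continuous_Tmat_gaugeJetAt`,
  **`continuous_TinvMat_gaugeJetAt`** (the entries of `T(γ(x))`, `T⁻¹(γ(x))` are continuous on `Λ` — the (II.42) denominator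
  never vanishes), `continuous_affineU_gaugeJetAt`, **`continuous_TinvMat_recover`** (the recovered field
  `Σ_b T⁻¹_ab(γ(x))(A′^b_μ(x) − U^b_μ(x))` is a continuous function on `Λ`).

**Readings (declared).** (P′)/(C′)/(W′)/(K) of `…MRS93PositionSpaceFields`; (T) the wedge-product sign is the print's.
No new reading.

**Honest status / what is NOT claimed.** (II.43)'s «Π_x» over ALL `x ∈ Λ` is, as printed, a «formal Lebesgue measure»
statement and stays formal: only the pointwise Jacobian and its finite products are typed. (II.44)/(II.45) (`G(A′, γ)`,
the Gaussian analogue) remain gen 6's READING (FD) theorems on finitely many sites (`gaussExpect_affine_change_blockT`);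
this file does not identify those sites with a quadrature of `Λ`, proves no estimate («H is a small matrix» is not a
theorem here beyond gen 0's closed form), instantiates nothing of (II.49)/(II.78), and says nothing about continuum YM₄
on `T⁴` without infrared cutoff, a mass gap, or Clay; nothing of Bałaban's.
-/

noncomputable section

open MeasureTheory Finset Complex

namespace Literature.MathematicalPhysics.QuantumFieldTheory.MagnenRivasseauSeneor1993

namespace PositionSpace

open MainStatement InfinitesimalGauge SectIV TruncatedGauge GhostGaussian

/-! ## §1 (II.41) pointwise on `Λ`: «A′ = A^{γ,2} = T(γ).A + U(γ)» for the cut-off fields -/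

/-- **«A′ = A^{γ,2} = T(γ).A + U(γ)» (p.341 tl.19–22 with (II.41)) AT EACH POINT OF `Λ`**: for a real cut-off configuration
`A` and a real cut-off `γ`, the colour vector of the position-space field `A′_μ(x)` of (II.6) is the (II.41) matrix
`T(γ(x)) = δ_ab − ε_abc λγ_c(x)` applied to `A_μ(x)`, plus `U_μ(γ)(x) = ∂_μγ(x) + (λ/2)[γ(x), ∂_μγ(x)]`.
[cite: MagnenRivasseauSeneor1993, §II.C p.341 tl.19–22, (II.41) p.341; (II.6) p.329 tl.16–18] -/
theorem truncField_re_eq_Tmat_mulVec_add (lam : ℝ) {S : Finset Momentum} {A : Config} (hA : IsRealOn S A)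
    {K : Finset (Fin 4 → ℤ)} {d : Fin 3 → (Fin 4 → ℤ) → ℂ} (hd : ∀ a, RealCoeff K (d a)) (x : Pos) (μ : Fin 4) :
    (fun a => (truncField S lam A K d μ a x).re) =
      (Tmat lam (gaugeJetAt K d x).val).mulVec ((jetAt S A x).val μ) + affineU lam (gaugeJetAt K d x) μ := by
  have h : (truncJetAt S lam A K d x).val μ = (gaugeTrunc2 lam (jetAt S A x) (gaugeJetAt K d x)).val μ := by
    rw [truncJetAt_eq lam hA hd x]
  rw [gaugeTrunc2_val_eq_Tmat_mulVec_add] at h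
  exact h

/-- The same, componentwise: `A′^a_μ(x) = Σ_b T_ab(γ(x)) A^b_μ(x) + U^a_μ(γ)(x)`.
[cite: MagnenRivasseauSeneor1993, §II.C p.341 tl.19–22, (II.41) p.341] -/
theorem truncField_re_apply (lam : ℝ) {S : Finset Momentum} {A : Config} (hA : IsRealOn S A)
    {K : Finset (Fin 4 → ℤ)} {d : Fin 3 → (Fin 4 → ℤ) → ℂ} (hd : ∀ a, RealCoeff K (d a)) (x : Pos) (μ : Fin 4)
    (a : Fin 3) :
    (truncField S lam A K d μ a x).re =
      ∑ b, Tmat lam (gaugeJetAt K d x).val a b * (field S A μ b x).re + affineU lam (gaugeJetAt K d x) μ a := by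
  have h := congrFun (truncField_re_eq_Tmat_mulVec_add lam hA hd x μ) a
  simpa only [Pi.add_apply, Matrix.mulVec, dotProduct, jetAt_val] using h

/-! ## §2 (II.42) pointwise on `Λ`: «the transformation A → A′ is therefore inverted by A = T⁻¹(A′ − U)» -/

/-- **«A = T⁻¹(A′ − U)» (p.341 tl.25–26 with (II.42)) AT EACH POINT OF `Λ`**: the cut-off field `A` is recovered from the
field `A′` of (II.6) and `γ` by the printed rational formula — `(A^a_μ(x))_a = T(γ(x))⁻¹·((A′^a_μ(x))_a − U_μ(γ)(x))` with
gen 0's closed-form inverse `TinvMat` of (II.42) («a rational function of γ», p.341 tl.17).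
[cite: MagnenRivasseauSeneor1993, §II.C p.341 tl.14–17, tl.23–26, (II.42) p.341] -/
theorem jetAt_val_eq_TinvMat_mulVec_truncField (lam : ℝ) {S : Finset Momentum} {A : Config} (hA : IsRealOn S A)
    {K : Finset (Fin 4 → ℤ)} {d : Fin 3 → (Fin 4 → ℤ) → ℂ} (hd : ∀ a, RealCoeff K (d a)) (x : Pos) (μ : Fin 4) :
    (jetAt S A x).val μ =
      (TinvMat lam (gaugeJetAt K d x).val).mulVec
        ((fun a => (truncField S lam A K d μ a x).re) - affineU lam (gaugeJetAt K d x) μ) := by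
  rw [truncField_re_eq_Tmat_mulVec_add lam hA hd x μ, add_sub_cancel_right]
  exact (mulVec_TinvMat_of_eq lam _ _ _ rfl).symm

/-- Componentwise: `A^a_μ(x) = Σ_b T⁻¹_ab(γ(x)) (A′^b_μ(x) − U^b_μ(γ)(x))`.
[cite: MagnenRivasseauSeneor1993, §II.C p.341 tl.23–26, (II.42) p.341] -/
theorem field_re_eq_TinvMat_apply (lam : ℝ) {S : Finset Momentum} {A : Config} (hA : IsRealOn S A)
    {K : Finset (Fin 4 → ℤ)} {d : Fin 3 → (Fin 4 → ℤ) → ℂ} (hd : ∀ a, RealCoeff K (d a)) (x : Pos) (μ : Fin 4)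
    (a : Fin 3) :
    (field S A μ a x).re =
      ∑ b, TinvMat lam (gaugeJetAt K d x).val a b *
        ((truncField S lam A K d μ b x).re - affineU lam (gaugeJetAt K d x) μ b) := by
  have h := congrFun (jetAt_val_eq_TinvMat_mulVec_truncField lam hA hd x μ) a
  simpa only [Pi.sub_apply, Matrix.mulVec, dotProduct, jetAt_val] using h

/-- **«this change of variables is one to one» (p.341 tl.14–16), POINTWISE**: two real cut-off configurations `A`, `B`
(same window `S`) whose truncated transforms by the same real cut-off `γ` agree at `x` in the direction `μ` have the
same field values there: `A_μ(x) = B_μ(x)`. [cite: MagnenRivasseauSeneor1993, §II.C p.341 tl.14–17, (II.42) p.341] -/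
theorem jetAt_val_eq_of_truncField_eq (lam : ℝ) {S : Finset Momentum} {A B : Config} (hA : IsRealOn S A)
    (hB : IsRealOn S B) {K : Finset (Fin 4 → ℤ)} {d : Fin 3 → (Fin 4 → ℤ) → ℂ} (hd : ∀ a, RealCoeff K (d a)) (x : Pos)
    (μ : Fin 4) (h : ∀ a, truncField S lam A K d μ a x = truncField S lam B K d μ a x) :
    (jetAt S A x).val μ = (jetAt S B x).val μ := by
  rw [jetAt_val_eq_TinvMat_mulVec_truncField lam hA hd x μ, jetAt_val_eq_TinvMat_mulVec_truncField lam hB hd x μ]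
  have hfun : (fun a => (truncField S lam A K d μ a x).re) = fun a => (truncField S lam B K d μ a x).re :=
    funext fun a => by rw [h a]
  rw [hfun]

/-- … hence the same position-space field values: `Re A^a_μ(x) = Re B^a_μ(x)` for every colour `a`.
[cite: MagnenRivasseauSeneor1993, §II.C p.341 tl.14–17] -/
theorem field_re_eq_of_truncField_eq (lam : ℝ) {S : Finset Momentum} {A B : Config} (hA : IsRealOn S A)
    (hB : IsRealOn S B) {K : Finset (Fin 4 → ℤ)} {d : Fin 3 → (Fin 4 → ℤ) → ℂ} (hd : ∀ a, RealCoeff K (d a)) (x : Pos)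
    (μ : Fin 4) (h : ∀ a, truncField S lam A K d μ a x = truncField S lam B K d μ a x) (a : Fin 3) :
    (field S A μ a x).re = (field S B μ a x).re := by
  have := congrFun (jetAt_val_eq_of_truncField_eq lam hA hB hd x μ h) a
  simpa only [jetAt_val] using this

/-! ## §3 (II.43): the Jacobian `J(γ(x)) = (1 + λ²γ²(x))⁻¹` as a function on `Λ`; its finite products = gen 6's block
determinants -/

/-- **The printed Jacobian ALONG THE CUT-OFF `γ`, AS A FUNCTION ON `Λ`**: gen 0's (II.43) `jacobianJ` at the value
`γ(x)` unfolds to the printed `J(γ(x)) = (1 + λ²γ²(x))⁻¹` with `γ²(x) = Σ_a (γ^a(x))²` (this file introduces no new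
definition: «J(γ(x))» below is always `jacobianJ λ (gaugeJetAt K γ̃ x).val`).
[cite: MagnenRivasseauSeneor1993, §II.C p.341 tl.27–31, (II.43) p.341] -/
theorem jacobianJ_gaugeJetAt_eq (lam : ℝ) (K : Finset (Fin 4 → ℤ)) (d : Fin 3 → (Fin 4 → ℤ) → ℂ) (x : Pos) :
    jacobianJ lam (gaugeJetAt K d x).val = (1 + lam ^ 2 * ∑ a, (trigPoly K (d a) x).re ^ 2)⁻¹ := rfl

/-- `J(γ(x)) = det T⁻¹(γ(x))` and `det T(γ(x)) · J(γ(x)) = 1` — «the linear piece is A → TA, and the Jacobian is J(γ)».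
[cite: MagnenRivasseauSeneor1993, §II.C p.341 tl.27–31, (II.41)–(II.43) p.341] -/
theorem jacobianJ_gaugeJetAt_eq_det (lam : ℝ) (K : Finset (Fin 4 → ℤ)) (d : Fin 3 → (Fin 4 → ℤ) → ℂ) (x : Pos) :
    jacobianJ lam (gaugeJetAt K d x).val = (TinvMat lam (gaugeJetAt K d x).val).det ∧
      (Tmat lam (gaugeJetAt K d x).val).det * jacobianJ lam (gaugeJetAt K d x).val = 1 :=
  ⟨(det_TinvMat_eq_jacobianJ lam _).symm, det_Tmat_mul_jacobianJ lam _⟩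

/-- `0 < J(γ(x))`. [cite: MagnenRivasseauSeneor1993, (II.43) p.341] -/
theorem jacobianJ_gaugeJetAt_pos (lam : ℝ) (K : Finset (Fin 4 → ℤ)) (d : Fin 3 → (Fin 4 → ℤ) → ℂ) (x : Pos) :
    0 < jacobianJ lam (gaugeJetAt K d x).val :=
  (jacobianJ_pos_le_one lam _).1

/-- `J(γ(x)) ≤ 1`. [cite: MagnenRivasseauSeneor1993, (II.43) p.341] -/
theorem jacobianJ_gaugeJetAt_le_one (lam : ℝ) (K : Finset (Fin 4 → ℤ)) (d : Fin 3 → (Fin 4 → ℤ) → ℂ) (x : Pos) :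
    jacobianJ lam (gaugeJetAt K d x).val ≤ 1 :=
  (jacobianJ_pos_le_one lam _).2

/-- **«For the truncated gauge transformation this is no longer exactly true»** (p.341 tl.29–30): `J(γ(x)) = 1` exactly iff
`λ = 0` or `γ(x) = 0`. [cite: MagnenRivasseauSeneor1993, §II.C p.341 tl.27–33, (II.43) p.341] -/
theorem jacobianJ_gaugeJetAt_eq_one_iff (lam : ℝ) (K : Finset (Fin 4 → ℤ)) (d : Fin 3 → (Fin 4 → ℤ) → ℂ) (x : Pos) :
    jacobianJ lam (gaugeJetAt K d x).val = 1 ↔ lam = 0 ∨ (gaugeJetAt K d x).val = 0 := by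
  rw [jacobianJ, inv_eq_one, add_eq_left, mul_eq_zero, sq_eq_zero_iff]
  refine or_congr Iff.rfl ?_
  rw [TruncatedGauge.normSq, Finset.sum_eq_zero_iff_of_nonneg fun a _ => sq_nonneg _]
  constructor
  · intro h
    funext a
    exact pow_eq_zero_iff (n := 2) two_ne_zero |>.mp (h a (Finset.mem_univ a))
  · intro h a _
    rw [h]
    simp

/-- `x ↦ J(γ(x))` is continuous on `Λ` (a rational function of the trigonometric polynomial `γ` with a positive
denominator). [cite: MagnenRivasseauSeneor1993, §II.C p.341 tl.16–17 «a rational function of γ», (II.43) p.341] -/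
theorem continuous_jacobianJ_gaugeJetAt (lam : ℝ) (K : Finset (Fin 4 → ℤ)) (d : Fin 3 → (Fin 4 → ℤ) → ℂ) :
    Continuous fun x => jacobianJ lam (gaugeJetAt K d x).val := by
  have hc : Continuous fun x => 1 + lam ^ 2 * ∑ a, (trigPoly K (d a) x).re ^ 2 :=
    continuous_const.add (continuous_const.mul (continuous_finsetSum _ fun a _ =>
      ((Complex.continuous_re.comp (continuous_trigPoly K (d a))).pow 2)))
  refine (hc.inv₀ fun x => ?_).congr fun x => (jacobianJ_gaugeJetAt_eq lam K d x).symm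
  have : 0 ≤ lam ^ 2 * ∑ a, (trigPoly K (d a) x).re ^ 2 :=
    mul_nonneg (sq_nonneg _) (Finset.sum_nonneg fun a _ => sq_nonneg _)
  linarith

/-- **(II.43) beyond one point — finite products of the Jacobian are gen 6's block determinants**: for every finite set
`X ⊂ Λ` of sample points, `Π_{x∈X} J(γ(x)) = |det ⊕_{x∈X} T(γ(x))|⁻¹`, the block matrix `blockT` of
`…MRS93GaussianChangeOfVariables` (READING (FD)) taken at the VALUES of the cut-off ghost field. The product over all of
`Λ` in (II.43) is the print's «formal Lebesgue measure» and is not typed.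
[cite: MagnenRivasseauSeneor1993, (II.43) p.341 tl.32–33, (II.44) p.341 tl.35–39] -/
theorem prod_jacobianJ_gaugeJetAt_eq (lam : ℝ) (K : Finset (Fin 4 → ℤ)) (d : Fin 3 → (Fin 4 → ℤ) → ℂ) (X : Finset Pos) :
    ∏ x ∈ X, jacobianJ lam (gaugeJetAt K d x).val = |(blockT lam fun x : X => (gaugeJetAt K d x).val).det|⁻¹ := by
  rw [abs_det_blockT, ← Finset.prod_inv_distrib]
  simp only [inv_inv]
  exact (Finset.prod_coe_sort X fun x => jacobianJ lam (gaugeJetAt K d x).val).symm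

/-- … equivalently `|det ⊕_{x∈X} T(γ(x))| · Π_{x∈X} J(γ(x)) = 1`. [cite: MagnenRivasseauSeneor1993, (II.43) p.341 tl.32–33] -/
theorem abs_det_blockT_mul_prod_jacobianJ_gaugeJetAt (lam : ℝ) (K : Finset (Fin 4 → ℤ)) (d : Fin 3 → (Fin 4 → ℤ) → ℂ)
    (X : Finset Pos) :
    |(blockT lam fun x : X => (gaugeJetAt K d x).val).det| * ∏ x ∈ X, jacobianJ lam (gaugeJetAt K d x).val = 1 := by
  rw [prod_jacobianJ_gaugeJetAt_eq]
  have hpos : 0 < |(blockT lam fun x : X => (gaugeJetAt K d x).val).det| :=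
    abs_pos.mpr (isUnit_det_blockT lam _).ne_zero
  exact mul_inv_cancel₀ hpos.ne'

/-! ## §4 «The inversion formula … is a rational function of γ» (p.341 tl.16–17): the entries of `T(γ(x))`, `T⁻¹(γ(x))`,
`U(γ)(x)` and the recovered field are continuous functions on `Λ` -/

/-- `x ↦ γ^a(x)` (the value slot of the jet of the cut-off `γ`) is continuous on `Λ`. [cite: MagnenRivasseauSeneor1993, §II.A (II.5) p.329; §IV p.352 tl.26–27] -/
theorem continuous_gaugeJetAt_val (K : Finset (Fin 4 → ℤ)) (d : Fin 3 → (Fin 4 → ℤ) → ℂ) (a : Fin 3) :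
    Continuous fun x => (gaugeJetAt K d x).val a :=
  Complex.continuous_re.comp (continuous_trigPoly K (d a))

/-- `x ↦ ∂_μγ^a(x)` (the derivative slot) is continuous on `Λ`. [cite: MagnenRivasseauSeneor1993, §II.A (II.5) p.329; §IV p.352 tl.26–27] -/
theorem continuous_gaugeJetAt_der (K : Finset (Fin 4 → ℤ)) (d : Fin 3 → (Fin 4 → ℤ) → ℂ) (μ : Fin 4) (a : Fin 3) :
    Continuous fun x => (gaugeJetAt K d x).der μ a :=
  Complex.continuous_re.comp (continuous_pderiv_trigPoly K (d a) μ 0).1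

/-- The entries of the (II.41) matrix along the cut-off `γ`, `x ↦ T_ab(γ(x))`, are continuous on `Λ` (affine in `γ(x)`).
[cite: MagnenRivasseauSeneor1993, (II.41) p.341] -/
theorem continuous_Tmat_gaugeJetAt (lam : ℝ) (K : Finset (Fin 4 → ℤ)) (d : Fin 3 → (Fin 4 → ℤ) → ℂ) (a b : Fin 3) :
    Continuous fun x => Tmat lam (gaugeJetAt K d x).val a b := by
  simp only [Tmat, Matrix.of_apply]
  exact continuous_const.sub (continuous_finsetSum _ fun c _ =>
    continuous_const.mul (continuous_gaugeJetAt_val K d c))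

/-- **The entries of the printed inverse (II.42) along the cut-off `γ`, `x ↦ T⁻¹_ab(γ(x))`, are continuous on `Λ`** — a
rational function of the trigonometric polynomial `γ` whose denominator `1 + λ²γ²(x)` never vanishes.
[cite: MagnenRivasseauSeneor1993, §II.C p.341 tl.16–17, (II.42) p.341] -/
theorem continuous_TinvMat_gaugeJetAt (lam : ℝ) (K : Finset (Fin 4 → ℤ)) (d : Fin 3 → (Fin 4 → ℤ) → ℂ)
    (a b : Fin 3) : Continuous fun x => TinvMat lam (gaugeJetAt K d x).val a b := by
  simp only [TinvMat, Matrix.of_apply]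
  have hγ := continuous_gaugeJetAt_val K d
  have hN : Continuous fun x => TruncatedGauge.normSq (gaugeJetAt K d x).val := by
    unfold TruncatedGauge.normSq
    exact continuous_finsetSum _ fun c _ => (hγ c).pow 2
  refine Continuous.mul ?_ ?_
  · exact continuous_const.div (continuous_const.add (continuous_const.mul hN))
      fun x => (one_add_sq_mul_normSq_pos lam _).ne'
  · exact (continuous_const.add (continuous_finsetSum _ fun c _ => continuous_const.mul (hγ c))).add
      ((continuous_const.mul (hγ a)).mul (hγ b))

/-- The affine part along the cut-off `γ`, `x ↦ U^a_μ(γ)(x) = ∂_μγ^a(x) + (λ/2)[γ(x), ∂_μγ(x)]^a`, is continuous on `Λ`.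
[cite: MagnenRivasseauSeneor1993, §II.C p.341 tl.19–20; (II.6) p.329] -/
theorem continuous_affineU_gaugeJetAt (lam : ℝ) (K : Finset (Fin 4 → ℤ)) (d : Fin 3 → (Fin 4 → ℤ) → ℂ) (μ : Fin 4)
    (a : Fin 3) : Continuous fun x => affineU lam (gaugeJetAt K d x) μ a := by
  simp only [affineU, Pi.add_apply, Pi.smul_apply, smul_eq_mul, TruncatedGauge.bracket]
  exact (continuous_gaugeJetAt_der K d μ a).add (continuous_const.mul (continuous_finsetSum _ fun b _ =>
    continuous_finsetSum _ fun c _ =>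
      (continuous_const.mul (continuous_gaugeJetAt_val K d b)).mul (continuous_gaugeJetAt_der K d μ c)))

/-- **The recovered field `x ↦ Σ_b T⁻¹_ab(γ(x))(A′^b_μ(x) − U^b_μ(γ)(x))` is a continuous function on `Λ`** (for real cut-off
data it IS `A^a_μ(x)`, `field_re_eq_TinvMat_apply`). [cite: MagnenRivasseauSeneor1993, §II.C p.341 tl.14–17, tl.25–26, (II.42) p.341] -/
theorem continuous_TinvMat_recover (S : Finset Momentum) (lam : ℝ) (A : Config) (K : Finset (Fin 4 → ℤ))
    (d : Fin 3 → (Fin 4 → ℤ) → ℂ) (μ : Fin 4) (a : Fin 3) :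
    Continuous fun x => ∑ b, TinvMat lam (gaugeJetAt K d x).val a b *
      ((truncField S lam A K d μ b x).re - affineU lam (gaugeJetAt K d x) μ b) :=
  continuous_finsetSum _ fun b _ => (continuous_TinvMat_gaugeJetAt lam K d a b).mul
    ((Complex.continuous_re.comp (continuous_truncField S lam A K d μ b)).sub (continuous_affineU_gaugeJetAt lam K d μ b))

end PositionSpace

end Literature.MathematicalPhysics.QuantumFieldTheory.MagnenRivasseauSeneor1993
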